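import Literature.NumberTheory.EllipticCurves.BurungaleKobayashiNakamuraOta2026.AnticyclotomicEllipticUnitClass
import Literature.NumberTheory.EllipticCurves.DeShalit1987.KatzPAdicLValue
import Literature.NumberTheory.GaloisRepresentations.WeakAbelianDirectSummandProofs
import Literature.NumberTheory.Automorphic.PairLFunctionPolesGLOneDedekindProofs
import HarnessLib

/-!
# K7r, line `rubin-formula-zp` (crux `EllipticUnitValueSevenOfGZK`, stmt-BirchSwinnertonDyer-19945), stub
# S_sat-Zp: ANATOMY OF THE BINDER `hvan` of (B1) `BottomClass.bottom_mem_compactSelmerOver` — level-`0`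
# rigidity, what `hvan` demands, why the companion binder `hcont` is unsatisfiable, and the REPAIRED
# reading over the tree's `HasEntireContinuationFrom (3/2)` in which «hvan ⟸ φ-pin» is a theorem
# (cell `bsd-cm`, seat `bsd-cm-k7r-c3` g7; THEOREMS ONLY — no definition, no named fact, nothing asserted)

HONEST FRAMING. The closer `RelaxedEqCompact.relaxed_le_mordellWeilKummerSpan_of_hvan` (seat k7r-c2,
p472558) of the registered stub S_sat-Zp (`X12.O11.RamifiedCMBottomSaturationAtZp W 7`) needs
`z(𝟙) ∈ S_p(E/K)`, obtained from (B1) `BottomClass.bottom_mem_compactSelmerOver` (seat ram, p446875)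
under its binder

  `hvan : ∀ χ r, IsAcCharacter ι κ 0 χ r → ∃ hL : LFunction.HasEntireContinuation (heckeLFunction (φ * χ)),
            hL.continuation 1 = 0`,

which the line card (`Lines/rubin-formula-zp.md`) expected to discharge from the φ-pin of the datum
(`∀ s, 3/2 < re s → heckeLFunction φ s = W.LSeries s`) and `r_an(W) = 1`. This file settles what can
be settled in the kernel about that step:

* §1 LEVEL-`0` RIGIDITY (proved): `IsAcCharacter ι κ 0 χ r ↔ χ = 1 ∧ r = 1` (`κ.layerSubgroup 0 = Γ_K`
  forces the avatar to be trivial; a Hecke character is determined by almost all `χ(ϖ_v)`,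
  Cassels–Fröhlich VII 4.1 via the tree's `HeckeCharacter.eq_of_hasFrobCharpolyAt_eventually`), and the
  pair `(𝟙, 𝟙)` IS of level `0` — so `hvan` is never vacuous.
* §2 WHAT `hvan` DEMANDS (proved): `hvan ↔ ∃ hL : LFunction.HasEntireContinuation (heckeLFunction φ),
  hL.continuation 1 = 0` — an entire function agreeing with the RAW `tprod` Euler product of `φ` at
  EVERY `s` with `re s > 1` (the threshold of `LFunction.HasEntireContinuation`, ArtinLFunction.lean).
  The φ-pin speaks only about `re s > 3/2`; it pins `φ` to weight one (`L(φ, s) = L(W, s)` in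
  Mathlib's integral normalisation, centre `s = 1`), whose Euler product converges absolutely on
  `re s > 3/2` ONLY. On the strip `1 < re s < 3/2` the `tprod` is the junk value of a non-multipliable
  product, so NO entire function can agree with it there while being `L(W, s)` further right: `hvan` is
  not derivable from the pin, and is in fact false at every pinned datum (the strip argument is
  mathematics, recorded in the cell memo MEMO-k7r-c3-g7-HVAN.md, not a kernel theorem of this file).
  Compare the honesty note of the Katz frame (`DeShalit1987/KatzPAdicLFunction.lean`, (T4)): the same
  binder is sound there only because the character has weight `≤ −1`.
* §3 VACUITY WITNESS (proved): the binder `hcont : ∀ χ, HasEntireContinuation (heckeLFunction (φ * χ))`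
  of `EllipticUnitClassData.z_eq` / `hasBottomIndexExp_iff` / `δ_sub_eq_zero` (and of the `hcont`-lemmas
  of `PadicEndSpan`, `LocalBottomIndex`) is FALSE for EVERY `φ`: `χ = φ⁻¹` asks for an entire
  continuation of `heckeLFunction 𝟙 = ζ_K`, which has a pole at `1` (Hecke's class number formula,
  PROVED in the tree: `Automorphic.tendsto_sub_one_mul_tprod_eulerFactor_one_numberField`).
* §4–§5 (the REPAIRED reading over `HasEntireContinuationFrom (3/2)`, in which «hvan′ ⟸ φ-pin» and
  (B1′) are theorems) are the companion file `RamifiedSevenEllipticUnitsHvanRepaired.lean`.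

CONSEQUENCES (planner tier, D-0014 — this seat edits no Literature structure): (a) at a pinned datum
the field `EllipticUnitClassData.erl` is vacuous as typed (it quantifies over an empty type), so the
datum carries no `L`-value content and (B1)/`…_of_hvan` cannot be fed — the S_sat-Zp closer must go
through the rank route or through a repaired `erl`; (b) repair (R-a) = replace
`LFunction.HasEntireContinuation (heckeLFunction (φ*χ))` / `hL.continuation 1` in `erl` (and in `hvan`,
`hcont`) by `HasEntireContinuationFrom (3/2) (heckeLFunction (φ*χ))` / `entireContinuationFrom (3/2) … 1`;
the companion file holds the lemmas the repaired line consumes; (c) the value law of 19945, S_open, S_dict′, S_B4′ and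
the IMC identity never mention `erl`/`hvan` and are untouched. Supports, does not close,
stmt-BirchSwinnertonDyer-19945. PARTITION: CornerF-ramified@7 (B13/O11) × 𝒞₇ × 7 — types-the-object-of.
BSD is not touched by any of this.

References: [BKNO] A. Burungale, S. Kobayashi, K. Nakamura, K. Ota, arXiv:2608.06879 (2026), Def. 4.2,
Prop. 4.10, Lemma 7.1 [BurungaleKobayashiNakamuraOta2026]; J. W. S. Cassels, A. Fröhlich (eds.),
*Algebraic Number Theory* (1967), Ch. VII §4 Prop. 4.1 [CasselsFrohlichANT1967]; J. Neukirch,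
*Algebraic Number Theory* (1999), Ch. VII (5.2), Cor. (5.11) [NeukirchANT1999]; J. Silverman, *Advanced
Topics in the Arithmetic of Elliptic Curves* (1994), Ch. II Thm. 10.5 [SilvermanATAEC1994]; cell files
`Lines/rubin-formula-zp.md`, STATUS 2026-08-27T00:21Z (this seat's FINDING), MEMO-k7r-c3-g7-HVAN.md.
-/

set_option linter.dupNamespace false

noncomputable section

open scoped Classical

open scoped Topology

open NumberField IsDedekindDomain Field Polynomial Filter Complex
  Literature.NumberTheory.GaloisRepresentations
  Literature.NumberTheory.EllipticCurves
  Literature.NumberTheory.EllipticCurves.BurungaleKobayashiNakamuraOta2026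

namespace Summit.BirchSwinnertonDyer.BirchSwinnertonDyer.Theorems.RamifiedSevenEllipticUnits.HvanAnatomy

/-! ### §1. Level-`0` rigidity: the only character pair of level `0` is `(𝟙, 𝟙)` -/

section LevelZero

variable {K : Type} [Field K] [NumberField K] {p : ℕ} [Fact p.Prime]
  {ι : PadicAlgCl p ≃+* ℂ} {κ : ZpExtension K p} {χ : HeckeCharacter K}
  {r : FramedGaloisRep K (PadicAlgCl p) 1}

omit [NumberField K] in
/-- A rank-one framed representation all of whose avatar values are `1` is the trivial
representation (`GL₁` is commutative of rank one: an invertible `1 × 1` matrix is its determinant,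
and `ℚ̄_p → ℂ_p` is injective). [folklore] -/
theorem framed_eq_one_of_forall_avatarValueAt_eq_one
    (h : ∀ σ : absoluteGaloisGroup K, avatarValueAt r σ = 1) : r = 1 := by
  refine ContinuousMonoidHom.ext fun σ ↦ ?_
  have hdet : Matrix.GeneralLinearGroup.det (r σ) = 1 := by
    have h1 := h σ
    rw [avatarValueAt] at h1
    have h2 : ((Matrix.GeneralLinearGroup.det (r σ) : (PadicAlgCl p)ˣ) : PadicAlgCl p) = 1 := by
      exact_mod_cast (UniformSpace.Completion.coe_injective (PadicAlgCl p)) (by simpa using h1)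
    exact Units.ext h2
  change r σ = 1
  ext i j
  have := congrArg (fun u : (PadicAlgCl p)ˣ ↦ (u : PadicAlgCl p)) hdet
  simp only [Matrix.GeneralLinearGroup.val_det_apply, Matrix.det_fin_one, Units.val_one] at this
  rw [Subsingleton.elim i 0, Subsingleton.elim j 0]
  simpa using this

/-- **Level-`0` characters have trivial avatar**: `IsAcCharacter ι κ 0 χ r → r = 1`
(`κ.layerSubgroup 0 = Γ_K`, so the `level` clause says `r(σ) = 1` for every `σ`).
[cite: BurungaleKobayashiNakamuraOta2026, Def. 4.2 (arXiv:2608.06879 p. 26) (shape only)] -/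
theorem framed_eq_one_of_isAcCharacter_zero (h : IsAcCharacter ι κ 0 χ r) : r = 1 :=
  framed_eq_one_of_forall_avatarValueAt_eq_one fun σ ↦
    h.level σ (by rw [ZpExtension.layerSubgroup_zero]; trivial)

/-- **Level-`0` rigidity: the only finite-order Hecke character of level `0` is the trivial one**,
`IsAcCharacter ι κ 0 χ r → χ = 1`: the avatar `r` is trivial, so `χ(ϖ_v) = 1` at almost every
place (the avatar dictionary at the places `v ∤ p` where `χ` is unramified), and a Hecke character is
determined by almost all of its values at uniformizers (Cassels–Fröhlich VII Prop. 4.1, tree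
`HeckeCharacter.eq_of_hasFrobCharpolyAt_eventually`).
[cite: CasselsFrohlichANT1967, Ch. VII §4 Prop. 4.1 (proof)] -/
theorem eq_one_of_isAcCharacter_zero (h : IsAcCharacter ι κ 0 χ r) : χ = 1 := by
  have hr : r = 1 := framed_eq_one_of_isAcCharacter_zero h
  have hp0 : ((p : ℕ) : 𝓞 K) ≠ 0 := Nat.cast_ne_zero.2 (Fact.out : p.Prime).ne_zero
  have hfin : ∀ᶠ v : HeightOneSpectrum (𝓞 K) in cofinite, ((p : ℕ) : 𝓞 K) ∉ v.asIdeal := by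
    have hset : {v : HeightOneSpectrum (𝓞 K) | ((p : ℕ) : 𝓞 K) ∈ v.asIdeal}.Finite := by
      have hf := Ideal.finite_factors (I := Ideal.span {((p : ℕ) : 𝓞 K)})
        (by rwa [Ne, Ideal.zero_eq_bot, Ideal.span_singleton_eq_bot])
      exact hf.subset fun v hv ↦ Ideal.dvd_span_singleton.2 hv
    refine eventually_cofinite.mpr ?_
    simpa only [not_not] using hset
  have hur : ∀ᶠ v : HeightOneSpectrum (𝓞 K) in cofinite, χ.IsUnramifiedAt v :=
    χ.finite_ramifiedPlaces_iff.1 (HeckeCharacter.finite_ramifiedPlaces_holds χ)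
  refine HeckeCharacter.eq_of_hasFrobCharpolyAt_eventually r ι ((hfin.and hur).mono fun v hv ↦ ?_)
    (hfin.mono fun v hv ↦ ?_)
  · have := (h.isAvatar v hv.1 hv.2).2
    rwa [← map_inv₀] at this
  · rw [hr]
    have := (isPAdicAvatarOf_one ι v hv (fun _ ↦ rfl)).2
    rwa [← map_inv₀] at this

/-- **The level-`0` pair exists: `(𝟙, 𝟙)` is a finite-order character of level `0` with its avatar**
(infinity type `(0,0)`; the trivial framed representation is the avatar of the trivial character,
factors through every `ℤ_p`-extension and has all avatar values `1`). So the binder `hvan` of (B1) is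
never vacuous. [cite: BurungaleKobayashiNakamuraOta2026, Def. 4.2 (arXiv:2608.06879 p. 26) (shape only)] -/
theorem isAcCharacter_zero_one_one (ι : PadicAlgCl p ≃+* ℂ) (κ : ZpExtension K p) :
    IsAcCharacter ι κ 0 (1 : HeckeCharacter K) (1 : FramedGaloisRep K (PadicAlgCl p) 1) where
  hasInfinityType := ⟨Set.univ, Filter.univ_mem, fun x _ ↦ by simp [HeckeCharacter.archFactor_apply]⟩
  isAvatar := isPAdicAvatarOf_one ι
  factorsThrough := factorsThroughZp_one κ
  level := fun σ _ ↦ avatarValueAt_one_left σ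

/-- **Level-`0` characters, exactly**: `IsAcCharacter ι κ 0 χ r ↔ χ = 1 ∧ r = 1`.
[cite: BurungaleKobayashiNakamuraOta2026, Def. 4.2 (arXiv:2608.06879 p. 26) (shape only)] -/
theorem isAcCharacter_zero_iff (ι : PadicAlgCl p ≃+* ℂ) (κ : ZpExtension K p) :
    IsAcCharacter ι κ 0 χ r ↔ χ = 1 ∧ r = 1 := by
  refine ⟨fun h ↦ ⟨eq_one_of_isAcCharacter_zero h, framed_eq_one_of_isAcCharacter_zero h⟩, ?_⟩
  rintro ⟨rfl, rfl⟩
  exact isAcCharacter_zero_one_one ι κ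

end LevelZero

/-! ### §2. What the binder `hvan` of (B1) demands: an entire continuation of `heckeLFunction φ`
ITSELF from the half-plane `re s > 1`, vanishing at `s = 1` -/

section Hvan

variable {K : Type} [Field K] [NumberField K] {p : ℕ} [Fact p.Prime]
  (ι : PadicAlgCl p ≃+* ℂ) (κ : ZpExtension K p) (φ : HeckeCharacter K)

/-- **`hvan ⟹` an entire continuation of `L(φ, s)` from `re s > 1` vanishing at `1`.** The binder
`hvan` of (B1) `BottomClass.bottom_mem_compactSelmerOver` (p446875) quantifies over ALL level-`0`
character pairs; the pair `(𝟙, 𝟙)` is one (`isAcCharacter_zero_one_one`), and `φ · 𝟙 = φ`. So `hvan`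
asks for `LFunction.HasEntireContinuation (heckeLFunction φ)` — an entire `g` with
`g s = heckeLFunction φ s` for EVERY `s` with `1 < re s` (ArtinLFunction's threshold), where
`heckeLFunction φ` is the raw `tprod` Euler product; the φ-pin of the line (`L(φ, s) = L(W, s)` on
`re s > 3/2` only) does not control the strip `1 < re s ≤ 3/2`. [folklore] -/
theorem exists_hasEntireContinuation_of_hvan
    (hvan : ∀ (χ : HeckeCharacter K) (r : FramedGaloisRep K (PadicAlgCl p) 1),
      IsAcCharacter ι κ 0 χ r →
        ∃ hL : LFunction.HasEntireContinuation (heckeLFunction (φ * χ)), hL.continuation 1 = 0) :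
    ∃ hL : LFunction.HasEntireContinuation (heckeLFunction φ), hL.continuation 1 = 0 := by
  have h := hvan 1 1 (isAcCharacter_zero_one_one ι κ)
  rwa [mul_one] at h

/-- **Conversely**, an entire continuation of `L(φ, s)` from `re s > 1` vanishing at `1` gives `hvan`
(level-`0` rigidity `eq_one_of_isAcCharacter_zero`: the only level-`0` character is `𝟙`). [folklore] -/
theorem hvan_of_exists_hasEntireContinuation
    (h : ∃ hL : LFunction.HasEntireContinuation (heckeLFunction φ), hL.continuation 1 = 0) :
    ∀ (χ : HeckeCharacter K) (r : FramedGaloisRep K (PadicAlgCl p) 1), IsAcCharacter ι κ 0 χ r →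
      ∃ hL : LFunction.HasEntireContinuation (heckeLFunction (φ * χ)), hL.continuation 1 = 0 := by
  intro χ r hχ
  obtain rfl := eq_one_of_isAcCharacter_zero hχ
  rwa [mul_one]

/-- **`hvan`, EXACTLY**: the binder of (B1) is equivalent to «`heckeLFunction φ` has an entire
continuation from `re s > 1` whose value at `1` is `0`». [folklore] -/
theorem hvan_iff :
    (∀ (χ : HeckeCharacter K) (r : FramedGaloisRep K (PadicAlgCl p) 1), IsAcCharacter ι κ 0 χ r →
      ∃ hL : LFunction.HasEntireContinuation (heckeLFunction (φ * χ)), hL.continuation 1 = 0) ↔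
    ∃ hL : LFunction.HasEntireContinuation (heckeLFunction φ), hL.continuation 1 = 0 :=
  ⟨exists_hasEntireContinuation_of_hvan ι κ φ, hvan_of_exists_hasEntireContinuation ι κ φ⟩

end Hvan

/-! ### §3. The binder `hcont` (ALL twists `φχ` have entire continuations from `re s > 1`) is
UNSATISFIABLE: `χ = φ⁻¹` gives the Dedekind zeta function, which has a pole at `s = 1` -/

section Hcont

variable {K : Type} [Field K] [NumberField K]

/-- The Euler product of the trivial Hecke character is the (full) Dedekind Euler product
`∏'_v (1 - q_v^{-s})⁻¹` (`𝟙` is unramified everywhere and `𝟙(ϖ_v) = 1`; reindexing by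
`Equiv.tprod_eq`). [cite: NeukirchANT1999, Ch. VII (5.2)] -/
theorem heckeLFunction_one_eq (s : ℂ) :
    heckeLFunction (1 : HeckeCharacter K) s =
      ∏' v : {v : HeightOneSpectrum (𝓞 K) // v ∉ (∅ : Set (HeightOneSpectrum (𝓞 K)))},
        (1 - ((v.1.residueCard : ℂ) ^ (-s)))⁻¹ := by
  rw [heckeLFunction]
  have e : ∀ v : HeightOneSpectrum (𝓞 K),
      v ∉ (∅ : Set (HeightOneSpectrum (𝓞 K))) ↔ (1 : HeckeCharacter K).IsUnramifiedAt v :=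
    fun v ↦ ⟨fun _ _ ↦ rfl, fun _ ↦ Set.notMem_empty v⟩
  have h1 : ∀ v : HeightOneSpectrum (𝓞 K), (1 : HeckeCharacter K).valueAtUniformizer v = 1 :=
    fun _ ↦ rfl
  rw [← Equiv.tprod_eq (Equiv.subtypeEquivRight e)
    (fun v : {v : HeightOneSpectrum (𝓞 K) // (1 : HeckeCharacter K).IsUnramifiedAt v} ↦
      (1 - (1 : HeckeCharacter K).valueAtUniformizer v.1 * ((v.1.residueCard : ℂ) ^ (-s)))⁻¹)]
  refine tprod_congr fun v ↦ ?_
  simp only [Equiv.subtypeEquivRight_apply_coe, h1, one_mul]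

/-- **`ζ_K` has no entire continuation**: `heckeLFunction 𝟙 = ∏'_v (1 - q_v^{-s})⁻¹` on `re s > 1`
has a (simple) pole at `s = 1` — `(s - 1) ζ_K(s) → res_K ≠ 0` (Hecke 1917, the analytic class
number formula; tree `tendsto_sub_one_mul_tprod_eulerFactor_one_numberField`, PROVED) — whereas for
an entire `g` agreeing with it on `re s > 1`, `(s - 1) g(s) → 0`. [cite: NeukirchANT1999, Ch. VII Cor. (5.11) (ii)] -/
theorem not_hasEntireContinuation_heckeLFunction_one :
    ¬ LFunction.HasEntireContinuation (heckeLFunction (1 : HeckeCharacter K)) := by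
  rintro ⟨g, hg, hgf⟩
  obtain ⟨c, hc, hlim⟩ :=
    Literature.NumberTheory.Automorphic.tendsto_sub_one_mul_tprod_eulerFactor_one_numberField
      (K := K) (S := (∅ : Set (HeightOneSpectrum (𝓞 K)))) Set.finite_empty
  have hg1 : Tendsto (fun s : ℂ ↦ (s - 1) * g s) (𝓝[{s : ℂ | 1 < s.re}] 1) (𝓝 0) := by
    have hcont : Continuous fun s : ℂ ↦ (s - 1) * g s :=
      (continuous_id.sub continuous_const).mul hg.continuous
    have := hcont.continuousAt (x := (1 : ℂ)).tendsto
    rw [sub_self, zero_mul] at this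
    exact this.mono_left nhdsWithin_le_nhds
  have heq : (fun s : ℂ ↦ (s - 1) *
      ∏' v : {v : HeightOneSpectrum (𝓞 K) // v ∉ (∅ : Set (HeightOneSpectrum (𝓞 K)))},
        (1 - ((v.1.residueCard : ℂ) ^ (-s)))⁻¹) =ᶠ[𝓝[{s : ℂ | 1 < s.re}] 1]
      fun s : ℂ ↦ (s - 1) * g s := by
    refine eventually_nhdsWithin_of_forall fun s hs ↦ ?_
    change (s - 1) * _ = (s - 1) * g s
    rw [← heckeLFunction_one_eq, hgf s hs]
  haveI : (𝓝[{s : ℂ | 1 < s.re}] (1 : ℂ)).NeBot :=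
    mem_closure_iff_nhdsWithin_neBot.mp (by rw [Complex.closure_setOf_lt_re]; simp)
  exact hc (tendsto_nhds_unique (hlim.congr' heq) hg1)

/-- **The binder `hcont` of `EllipticUnitClassData.z_eq` / `hasBottomIndexExp_iff` /
`δ_sub_eq_zero` (and of the `hcont`-lemmas of `PadicEndSpan`, `LocalBottomIndex`) is UNSATISFIABLE
for EVERY `φ`**: `∀ χ, HasEntireContinuation (heckeLFunction (φ * χ))` fails at `χ = φ⁻¹`
(`φ φ⁻¹ = 𝟙`, `not_hasEntireContinuation_heckeLFunction_one`). Those theorems are therefore vacuous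
as typed (a vacuity witness; the statements stay true). [cite: NeukirchANT1999, Ch. VII Cor. (5.11) (ii)] -/
theorem not_forall_hasEntireContinuation_heckeLFunction_mul (φ : HeckeCharacter K) :
    ¬ ∀ χ : HeckeCharacter K, LFunction.HasEntireContinuation (heckeLFunction (φ * χ)) := by
  intro h
  have h1 := h φ⁻¹
  rw [mul_inv_cancel] at h1
  exact not_hasEntireContinuation_heckeLFunction_one h1

end Hcont

end Summit.BirchSwinnertonDyer.BirchSwinnertonDyer.Theorems.RamifiedSevenEllipticUnits.HvanAnatomy

end
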